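/-
Copyright (c) 2026 the pub-hodgecm-mathlib formalisation cell (harness21).  R90-TF SLAB, section S10 (Rogawski 1990, Ch. 13.8 read at `v`), prover R90-C138-p04 (g2) —
DEAL #108 (dealer R90-C138-plan (g4), 2026-09-05): the `hSat` ADAPTER — the keystone's PS-side binder `hSat` from the named letter `SatakeParameterOfRhoLetter` under ⟪U⟫;
h413 = `stmt-HodgeConjecture-24833`, route `HCCMUnconditional`.
-/
import Summits.HodgeConjecture.HodgeConjecture.Theorems.R90S10SatakeParameterOfRhoLetterDefs  -- ★ p865321 (K2E3-p12): `SatakeParameterOfRhoLetter`, bridge `S10HDatum.hSat_of_satakeParameterOfRhoLetter` (+ ★ p865188 `finrank_fixedPoints_rho_eq_one`)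
import Summits.HodgeConjecture.HodgeConjecture.Theorems.R90S10HPSFlatOfSatake                 -- ★ p865337 (K2Liu-p26): `S10FrozenDatum.hPSFlat_of_hSat` (the `hSat` binder of record :89–:96) (+ ★ p865109 `S10HDatum.x₀_ne_zero`)
import HarnessLib

/-!
# R90-TF ∕ S10 — THE `hSat` ADAPTER: the keystone's PS-side binder from the letter `SatakeParameterOfRhoLetter` under ⟪U⟫ (`Theorems/R90S10HSatOfLetter.lean`;
# ns `Summit.HodgeConjecture.HodgeConjecture.R90.S10`)

Cell `hodgecm-mathlib`, crux H413 (`stmt-HodgeConjecture-24833`), route of record `HCCMUnconditional`; programme R90-TF, section S10 (base `R90-C138`).  PROOF lane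
(`--kind proof --supports stmt-HodgeConjecture-24833 --as helper`): theorems only; no `def`, no instance, no notation, no `sorry`; imports ★ only (law L9).
DEAL #108 (R90-C138-plan (g4), 04:16:23Z): ★ p865337 `S10FrozenDatum.hPSFlat_of_hSat` (the `hPS♭` assembly) and its corollaries bind, at every `w ≠ v`, the letter `hSat`
(:89–:96): «some unramified principal series `i_H(χ₂ ⊠ χ₁)` of `H_w`, `χ₁` smooth, has a `K_{H,w}`-line with THE algebra character of `ρ_w`'s `K_{H,w}`-line» — the line of
`ρ_w` being ★ (`dim ρ_w^{K_H} = 1`: ★ (b1) `S10HDatum.x₀_ne_zero` + ★ `finrank_fixedPoints_rho_eq_one`).  ★ p865321 typed the datum-free named letter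
`SatakeParameterOfRhoLetter L w` («every character of `ℋ(H_w, K_H^{std})` on a line is a Satake parameter», [CartierCorvallis1979] §IV.1 Cor. 4.2, under ⟪U⟫ at `w`) with the
bridge `S10HDatum.hSat_of_satakeParameterOfRhoLetter (hw) (hU) (h) (hline1)`.  THIS FILE is the one-line adapter the keystone consumers call: from ⟪U⟫ VERBATIM
(`∀ w ≠ v, ∀ W ∣ w, IsUnramifiedAt (𝓞 L⁺) W ∧ μ.IsUnramifiedAt W` — its first conjunct is the bridge's `hU`) and the letter at every `w ≠ v`, the binder `hSat` of ★ p865337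
TOKEN FOR TOKEN (`hline1` := the SAME term `𝔣.𝔥.finrank_fixedPoints_rho_eq_one w.2 (S10HDatum.x₀_ne_zero … 𝔣.𝔥 w.1 w.2)`, so the two `∃ hlineP, … = unopSphericalCharacter … hline1`
shapes coincide syntactically).

CONTENTS: `S10HDatum.hSat_of_letter` (datum level, one place `w ≠ v`), **`S10FrozenDatum.hSat_of_letter`** (the keystone binder: all `w ≠ v`), and the composite
`S10FrozenDatum.hPSFlat_of_letter` (= ★ `hPSFlat_of_hSat` ∘ `hSat_of_letter`: the level-trace letter `hPS♭` from ⟪U⟫ + `SatakeParameterOfRhoLetter`).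
HONEST LABEL: adapter over the NAMED, UNPROVED letter `SatakeParameterOfRhoLetter` (typ3's ED. 11β sub-socket `sock_S10_satakeParameterOfRho`) — pays nothing printed; HC_CM is proved
only modulo the 7 printed citations (2 remaining named inputs: hLiu418 = `stmt-HodgeConjecture-24832`, h413 = `stmt-HodgeConjecture-24833`) until rung 0 closes; REL ≠ ★ ≠ BUILT.

## References
* [Rogawski1990] J. D. Rogawski, *Automorphic Representations of Unitary Groups in Three Variables*, Ann. of Math. Stud. 123 (1990), §12.1 pp. 171–172; §13.8 p. 218 L9, p. 219 L2–L3.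
* [CartierCorvallis1979] P. Cartier, *Representations of p-adic groups: a survey*, PSPM 33.1 (1979), §IV.1 Thm. 4.1, Cor. 4.1–4.2.
-/

set_option autoImplicit false
set_option linter.dupNamespace false

noncomputable section

open scoped RestrictedProduct
open Filter MeasureTheory NumberField IsDedekindDomain CompactlySupported Topology
open Literature.NumberTheory.Rogawski1990 Literature.NumberTheory.Automorphic Literature.NumberTheory.Automorphic.UnitaryGroup
open Literature.NumberTheory.GaloisRepresentations (HeckeCharacter)
open Summit.HodgeConjecture.HodgeConjecture.Cruxes.H413
open Summit.HodgeConjecture.HodgeConjecture.Cruxes.H413.K2E1TraceFormulaBeta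
open Summit.HodgeConjecture.HodgeConjecture.Cruxes.H413.K2E1EigenvaluePackageOfSpherical
open Summit.HodgeConjecture.HodgeConjecture.Cruxes.H413.K2E1EvpOfAutomorphicClass

namespace Summit.HodgeConjecture.HodgeConjecture.R90.S10

section Frozen

variable {L : Type} [Field L] [NumberField L] [IsCMField L] [DecidableEq (Pl L)] {μ : HeckeCharacter L} {v : Pl L}
  [MeasurableSpace (HLoc L v)] [BorelSpace (HLoc L v)] [MeasurableSpace (Gqs L v)] [BorelSpace (Gqs L v)]
  {νHv : Measure (HLoc L v)} {νQv : Measure (Gqs L v)} [νHv.IsHaarMeasure] [νHv.IsMulRightInvariant] [νQv.IsHaarMeasure] [νQv.IsMulRightInvariant]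
  [∀ a : HLoc L v, MeasurableSpace (HLoc L v ⧸ Subgroup.centralizer ({a} : Set (HLoc L v)))]
  [∀ a : HLoc L v, BorelSpace (HLoc L v ⧸ Subgroup.centralizer ({a} : Set (HLoc L v)))]
  [∀ γ : Gqs L v, MeasurableSpace (Gqs L v ⧸ Subgroup.centralizer ({γ} : Set (Gqs L v)))]
  [∀ γ : Gqs L v, BorelSpace (Gqs L v ⧸ Subgroup.centralizer ({γ} : Set (Gqs L v)))]
  {mHv : OrbitalMeasureFamily (HLoc L v)} {mQv : OrbitalMeasureFamily (Gqs L v)} {πSt : IrrClass (HLoc L v)}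
  [MeasurableSpace (G3 L).Adelic] [BorelSpace (G3 L).Adelic] [MeasurableSpace (H2 L).Adelic] [BorelSpace (H2 L).Adelic]
  [MeasurableSpace (GArch L)] [BorelSpace (GArch L)] [MeasurableSpace (HArch L)] [BorelSpace (HArch L)]
  [MeasurableSpace (H1Loc L v)] [MeasurableSpace (H1Arch L)] [MeasurableSpace (H1 L).Adelic] [BorelSpace (H1 L).Adelic]

omit [MeasurableSpace (G3 L).Adelic] [BorelSpace (G3 L).Adelic] in
set_option maxHeartbeats 800000 in -- the statement carries ★ p865188's `hSat` shape (two `cmPrincipalSeriesH` fixed-point types); as in ★ p865321 :107 ∕ ★ p865337, default 200000 is exhausted at `whnf`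
/-- **`hSat` AT ONE PLACE `w ≠ v` OF THE `H`-DATUM, from ⟪U⟫ and the letter** (★ bridge `hSat_of_satakeParameterOfRhoLetter` with `hU := (⟪U⟫ w).1` and the ★ line
`dim ρ_w^{K_{H,w}} = 1`). [cite: CartierCorvallis1979, §IV.1 Cor. 4.2] [cite: Rogawski1990, §13.8 p. 218 L9, p. 219 L2–L3] -/
theorem S10HDatum.hSat_of_letter (𝔥 : S10HDatum L μ v νHv νQv mHv mQv πSt)
    (hunr : ∀ w : Pl L, w ≠ v → ∀ W : PlacesOver L w, Algebra.IsUnramifiedAt (𝓞 ↥(maximalRealSubfield L)) W.1.asIdeal ∧ μ.IsUnramifiedAt W.1)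
    {w : Pl L} (hw : w ≠ v) (hSPR : SatakeParameterOfRhoLetter L w) :
    letI := 𝔥.acV w
    letI := 𝔥.mdV w
    ∃ (χ₂ : ↥(torusU (conjLocal L (IsCMField.complexConj L) w) (cmLocalForm L 2 w)) →* ℂˣ) (χ₁ : H1Loc L w →* ℂˣ),
      IsOpen ((χ₁.ker : Subgroup (H1Loc L w)) : Set (H1Loc L w)) ∧
        ∃ hlineP : Module.finrank ℂ ↥((cmPrincipalSeriesH L w χ₂ χ₁).fixedPoints (𝔥.KH w)) = 1,
          unopSphericalCharacter (𝔥.KH w) (cmPrincipalSeriesH L w χ₂ χ₁) hlineP =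
            unopSphericalCharacter (𝔥.KH w) (𝔥.ρ w) (𝔥.finrank_fixedPoints_rho_eq_one hw (S10HDatum.x₀_ne_zero L μ v νHv νQv mHv mQv πSt 𝔥 w hw)) :=
  𝔥.hSat_of_satakeParameterOfRhoLetter hw (fun W => (hunr w hw W).1) hSPR
    (𝔥.finrank_fixedPoints_rho_eq_one hw (S10HDatum.x₀_ne_zero L μ v νHv νQv mHv mQv πSt 𝔥 w hw))

set_option maxHeartbeats 800000 in -- same statement shape as ★ p865337 :89–:96 (binder VERBATIM); default 200000 is exhausted at `whnf`
/-- **`hSat_of_letter` — THE KEYSTONE'S `hSat` BINDER (★ p865337 :89–:96, TOKEN FOR TOKEN) from ⟪U⟫ VERBATIM and `SatakeParameterOfRhoLetter` at every `w ≠ v`.**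
Consumers: `hSat := 𝔣.hSat_of_letter hunr hSPR`. [cite: CartierCorvallis1979, §IV.1 Cor. 4.2] [cite: Rogawski1990, §12.1 pp. 171–172; §13.8 p. 219 L2–L3] -/
theorem S10FrozenDatum.hSat_of_letter (𝔣 : S10FrozenDatum L μ v νHv νQv mHv mQv πSt)
    (hunr : ∀ w : Pl L, w ≠ v → ∀ W : PlacesOver L w, Algebra.IsUnramifiedAt (𝓞 ↥(maximalRealSubfield L)) W.1.asIdeal ∧ μ.IsUnramifiedAt W.1)
    (hSPR : ∀ w : {w : Pl L // w ≠ v}, SatakeParameterOfRhoLetter L w.1) :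
    ∀ w : {w : Pl L // w ≠ v},
      letI := 𝔣.𝔥.acV w.1
      letI := 𝔣.𝔥.mdV w.1
      ∃ (χ₂ : ↥(torusU (conjLocal L (IsCMField.complexConj L) w.1) (cmLocalForm L 2 w.1)) →* ℂˣ) (χ₁ : H1Loc L w.1 →* ℂˣ),
        IsOpen ((χ₁.ker : Subgroup (H1Loc L w.1)) : Set (H1Loc L w.1)) ∧
          ∃ hlineP : Module.finrank ℂ ↥((cmPrincipalSeriesH L w.1 χ₂ χ₁).fixedPoints (𝔣.𝔥.KH w.1)) = 1,
            unopSphericalCharacter (𝔣.𝔥.KH w.1) (cmPrincipalSeriesH L w.1 χ₂ χ₁) hlineP =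
              unopSphericalCharacter (𝔣.𝔥.KH w.1) (𝔣.𝔥.ρ w.1) (𝔣.𝔥.finrank_fixedPoints_rho_eq_one w.2 (S10HDatum.x₀_ne_zero L μ v νHv νQv mHv mQv πSt 𝔣.𝔥 w.1 w.2)) :=
  fun w => 𝔣.𝔥.hSat_of_letter hunr w.2 (hSPR w)

set_option maxHeartbeats 800000 in -- ★ p865337's own head needs 800000 (:73); this is its one-line instantiation
/-- **`hPS♭` FROM ⟪U⟫ AND THE LETTER** — ★ p865337 `hPSFlat_of_hSat` fed with `hSat_of_letter`: at every `w ≠ v` some unramified principal series `i_H(χ₂ ⊠ χ₁)` (`χ₁` smooth,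
a `K_{H,w}`-line) has the same `K_{H,w}`-level traces as `ρ_w`. [cite: Rogawski1990, §13.8 p. 219 L2–L3; §12.1 pp. 171–172] [cite: CartierCorvallis1979, §IV.1 Thm. 4.1, Cor. 4.1–4.2] -/
theorem S10FrozenDatum.hPSFlat_of_letter (𝔣 : S10FrozenDatum L μ v νHv νQv mHv mQv πSt)
    (hunr : ∀ w : Pl L, w ≠ v → ∀ W : PlacesOver L w, Algebra.IsUnramifiedAt (𝓞 ↥(maximalRealSubfield L)) W.1.asIdeal ∧ μ.IsUnramifiedAt W.1)
    (hSPR : ∀ w : {w : Pl L // w ≠ v}, SatakeParameterOfRhoLetter L w.1) :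
    ∀ w : {w : Pl L // w ≠ v}, ∃ (χ₂ : ↥(torusU (conjLocal L (IsCMField.complexConj L) w.1) (cmLocalForm L 2 w.1)) →* ℂˣ) (χ₁ : H1Loc L w.1 →* ℂˣ),
      IsOpen ((χ₁.ker : Subgroup (H1Loc L w.1)) : Set (H1Loc L w.1)) ∧
        Module.finrank ℂ ↥((cmPrincipalSeriesH L w.1 χ₂ χ₁).fixedPoints (𝔣.𝔥.KH w.1)) = 1 ∧
          (letI := 𝔣.𝔥.acV w.1
           letI := 𝔣.𝔥.mdV w.1
           letI := 𝔣.𝔳.msH w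
           ∀ fH : HLoc L w.1 → ℂ, IsLocSmooth fH → IsLevel (𝔣.𝔥.KH w.1) fH →
             (𝔣.𝔥.ρ w.1).smoothTrace (𝔣.𝔳.νHw w) fH = (cmPrincipalSeriesH L w.1 χ₂ χ₁).smoothTrace (𝔣.𝔳.νHw w) fH) :=
  𝔣.hPSFlat_of_hSat (𝔣.hSat_of_letter hunr hSPR)

end Frozen

end Summit.HodgeConjecture.HodgeConjecture.R90.S10

end
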